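import Mathlib
import Literature.NumberTheory.Automorphic.ClozelAlgebraicity
import Literature.NumberTheory.Automorphic.ClozelAlgebraicitySplit
import Summits.Langlands.Langlands.Theorems.IrreducibilityBySelfDualityHeckeEigenvalueFieldStubS3
import Summits.Langlands.Langlands.Theorems.IrreducibilityBySelfDualityHeckeEigenvalueFieldBaireFinal
import Summits.Langlands.Langlands.Theses.IrreducibilityBySelfDuality

/-!
# Crux `HeckeEigenvalueField` (stmt-Langlands-13632) — line `BaireSketch`, lead skeleton (v4, final shape)

Everything of the line is LANDED except the one stub below:
* (S3)  `stub_S3` (`…StubS3.lean`), (UNIF) `uniform_of_countable_autOrbit` (`…BaireUnif.lean`);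
* (S4)  `S4_of_stubs` / `countable_heckeEigensystems` (`…S4.lean`, from `…StubA`, `…StubB` (`…StubB1`,
  `…StubB2`), `…StubC1`, `…StubC2`, `…StubC3`);
* the composition `heckeEigenvalueField_of_S3_S4_conj` and the conditional closures
  `clozel1990_heckeEigenvalueField_of_exists_autConjugate`, `clozel1990_regularAlgebraic_of_exists_autConjugate`,
  `HeckeEigenvalueField_of_exists_autConjugate` (`…BaireClosure.lean`, `…BaireFinal.lean`);
* (ii)  `stub_autConjugates` — OPEN: it is the named fact `Clozel1990_exists_autConjugate` (clause (ii) of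
  Clozel 1990 Thm. 3.13, `ClozelAlgebraicitySplit.lean`; `autConjugates_of_exists_autConjugate`), unproved in
  the tree for `n ≥ 2` (`n = 1`: `exists_cuspidal_isAutConjugate_rank_one`; `σ = c`: `exists_isAutConjugate_conj`).
`HeckeEigenvalueField_of` concludes the crux BY NAME modulo that stub.
-/

set_option linter.dupNamespace false -- project-wide: `Summit.Langlands.Langlands` is the mandated namespace

noncomputable section

open scoped Classical
open Filter NumberField IsDedekindDomain
open Literature.NumberTheory.Automorphic

namespace Summit.Langlands.Langlands.Theorems.HeckeEigenvalueField.Baire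

/-! ## The stub -/

open Literature.NumberTheory.Automorphic in
/-- **(ii) stub** — clause (ii) of Clozel 1990, Thm. 3.13 (`Clozel1990_exists_autConjugate`):
regular algebraic cuspidal `Aut(ℂ)`-conjugates exist at almost all places. Blocked on the named
fact; see `autConjugates_of_exists_autConjugate` (landed, `…BaireClosure.lean`). [cite: Clozel1990, Thm. 3.13] -/
theorem stub_autConjugates : ∀ (n : ℕ) (K : Type) [Field K] [NumberField K]
    (hcpt : isCompact_glFiniteIntegralLevel n K)
    (π : CuspidalAutomorphicRepData n K hcpt), π.1.IsRegularAlgebraic → ∀ σ : ℂ ≃ₐ[ℚ] ℂ,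
      ∃ π' : CuspidalAutomorphicRepData n K hcpt, IsAutConjugate σ π.1 π'.1 ∧ π'.1.IsRegularAlgebraic := by
  sorry

/-! ## The composition -/

/-- **The crux by name, modulo the one registered open stub** `stub_autConjugates`: the landed
reduction `clozel1990_heckeEigenvalueField_of_autConjugates` (`…BaireFinal.lean`: (S3) + UNIF + (S4), all theorems) applied
to the stub; the named fact `Clozel1990_heckeEigenvalueField` it produces is definitionally the route decl.
[folklore] -/
theorem HeckeEigenvalueField_of :
    Summit.Langlands.Langlands.Theses.IrreducibilityBySelfDuality.HeckeEigenvalueField :=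
  clozel1990_heckeEigenvalueField_of_autConjugates stub_autConjugates

end Summit.Langlands.Langlands.Theorems.HeckeEigenvalueField.Baire

end
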